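import Summits.AtomisticToContinuum.FouriersLaw.Theses.CageBudgetFekete

/-!
# Negative lemma for `CageBudgetFekete.QuasiSuperadditiveHeatVariance` (stmt-AtomisticToContinuum-15769)

`quasiSuperadditiveHeatVariance_false_without_dynamics`: the ANALYTIC SHELL of the crux — the
crux with the guarded pair `(μ_T, D)` forgotten and replaced by everything the sibling analytic
items assert about the memory `C_T` (continuity; evenness = time reversal; `|C_T| ≤ C_T(0)`;
`C_T ∈ L¹(0,∞)` with `0 < ∫₀^∞ C_T`, i.e. the Green–Kubo content of
`FourierGreenKubo.GreenKubo` (stmt-AtomisticToContinuum-0703) up to the factor `T⁻²`; and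
`V_T ≥ 0` from `HeatVarianceCalculus` (stmt-AtomisticToContinuum-15772)) — is FALSE.

Witness: the "cage lobe" memory `C(t) = 4(1+|t|)⁻³ − (1+|t|)⁻²`: `C(0) = 3`, `∫₀^∞ C = 1`,
`|C| ≤ 3`, heat variance `V(τ) = 2∫₀^τ (τ−s)C(s)ds = 2(τ(τ−1)/(1+τ) + log(1+τ)) ≥ 0`, but
`2V(n) − V(2n) ≥ 2 log((1+n)/2) − 8 → ∞`: the first moment of the negative part of the memory,
`∫₀^R t·C⁻(t)dt ~ log R`, diverges although `C ∈ L¹`.  Hence the route header's kill criterion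
"proof of GreenKubo (C_T ∈ L¹, κ_GK > 0) moots Q" is NOT available for Q: any proof of the crux
must use the dynamics beyond `L¹`-ness of the memory (the load-bearing quantity is `∫ t·C_T⁻`,
cf. the line `Lines/birth.lean`, stub `stub_negativeMemoryMoment`).  (The Laplace identity of
`HeatVarianceCalculus` holds for every continuous memory of linear-growth variance, so it adds no
constraint; a positive-definite witness also exists on paper — spectral density `∝ |ω|^{1/2}`
near `ω = 0`, `C(t) = e^{−|t|} + Re (1 − i|t|)^{−3/2}` — not formalised here.)
-/

namespace Summit.AtomisticToContinuum.FouriersLaw.Theorems.QuasiSuperadditiveHeatVariance.Negative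

open MeasureTheory Set Filter Topology

/-! ### Calculus of `u(s) = (1+s)⁻¹` on `[0, ∞)` -/

/-- `d/ds (1+s)⁻¹ = −(1+s)⁻²` for `s ≥ 0`. [folklore] -/
theorem hasDerivAt_inv_one_add {x : ℝ} (hx : 0 ≤ x) :
    HasDerivAt (fun s : ℝ => (1 + s)⁻¹) (-(((1 + x)⁻¹) ^ 2)) x := by
  have hne : (1 + x) ≠ 0 := by positivity
  have h := ((hasDerivAt_id' x).const_add (1:ℝ)).fun_inv hne
  refine h.congr_deriv ?_
  rw [inv_pow, neg_div, one_div]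

/-- `(1+s)⁻¹ → 0` as `s → ∞`. [folklore] -/
theorem tendsto_inv_one_add : Tendsto (fun s : ℝ => (1 + s)⁻¹) atTop (𝓝 0) :=
  tendsto_inv_atTop_zero.comp (tendsto_atTop_add_const_left atTop 1 tendsto_id)

/-- `4(1+s)⁻³` is integrable on `(0,∞)` (derivative of `−2(1+s)⁻² ↑ 0`). [folklore] -/
theorem integrableOn_piece3 : IntegrableOn (fun s : ℝ => 4 * ((1 + s)⁻¹) ^ 3) (Ioi 0) := by
  refine integrableOn_Ioi_deriv_of_nonneg' (g := fun s : ℝ => -2 * ((1 + s)⁻¹ * (1 + s)⁻¹))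
    (a := 0) (l := 0) ?_ ?_ ?_
  · intro x hx
    have hu := hasDerivAt_inv_one_add (x := x) hx.out
    exact ((hu.fun_mul hu).const_mul (-2)).congr_deriv (by ring)
  · intro x hx
    have : 0 < 1 + x := by linarith [hx.out]
    positivity
  · simpa using (tendsto_inv_one_add.mul tendsto_inv_one_add).const_mul (-2)

/-- `(1+s)⁻²` is integrable on `(0,∞)` (derivative of `−(1+s)⁻¹ ↑ 0`). [folklore] -/
theorem integrableOn_piece2 : IntegrableOn (fun s : ℝ => ((1 + s)⁻¹) ^ 2) (Ioi 0) := by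
  refine integrableOn_Ioi_deriv_of_nonneg' (g := fun s : ℝ => -(1 + s)⁻¹) (a := 0) (l := 0)
    ?_ ?_ ?_
  · intro x hx
    have hu := hasDerivAt_inv_one_add (x := x) hx.out
    exact hu.fun_neg.congr_deriv (by ring)
  · intro x _
    positivity
  · simpa using tendsto_inv_one_add.neg

/-- `4(1+s)⁻³ − (1+s)⁻²` is integrable on `(0,∞)`. [folklore] -/
theorem integrableOn_pieces :
    IntegrableOn (fun s : ℝ => 4 * ((1 + s)⁻¹) ^ 3 - ((1 + s)⁻¹) ^ 2) (Ioi 0) :=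
  integrableOn_piece3.sub integrableOn_piece2

/-- `∫₀^∞ (4(1+s)⁻³ − (1+s)⁻²) ds = 1` (antiderivative `−2(1+s)⁻² + (1+s)⁻¹ ↑ 0`). [folklore] -/
theorem integral_pieces :
    ∫ t in Ioi (0:ℝ), (4 * ((1 + t)⁻¹) ^ 3 - ((1 + t)⁻¹) ^ 2) = 1 := by
  have hF : ∫ t in Ioi (0:ℝ), (4 * ((1 + t)⁻¹) ^ 3 - ((1 + t)⁻¹) ^ 2)
      = 0 - (fun s : ℝ => -2 * ((1 + s)⁻¹ * (1 + s)⁻¹) + (1 + s)⁻¹) 0 := by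
    refine integral_Ioi_of_hasDerivAt_of_tendsto'
      (f := fun s : ℝ => -2 * ((1 + s)⁻¹ * (1 + s)⁻¹) + (1 + s)⁻¹) (a := 0) (m := 0)
      ?_ integrableOn_pieces ?_
    · intro x hx
      have hu := hasDerivAt_inv_one_add (x := x) hx.out
      exact (((hu.fun_mul hu).const_mul (-2)).fun_add hu).congr_deriv (by ring)
    · simpa using ((tendsto_inv_one_add.mul tendsto_inv_one_add).const_mul (-2)).add
        tendsto_inv_one_add
  rw [hF]
  norm_num

/-- The heat variance of the witness is nonnegative in closed form (`log(1+τ) ≥ τ/(1+τ)`). [folklore] -/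
theorem heatVariance_closedForm_nonneg {τ : ℝ} (hτ : 0 ≤ τ) :
    0 ≤ 2 * (τ * (τ - 1) / (1 + τ) + Real.log (1 + τ)) := by
  have hpos : 0 < 1 + τ := by positivity
  have hl : 1 - (1 + τ)⁻¹ ≤ Real.log (1 + τ) := Real.one_sub_inv_le_log_of_pos hpos
  have e : τ * (τ - 1) / (1 + τ) + (1 - (1 + τ)⁻¹) = τ ^ 2 / (1 + τ) := by
    field_simp
    ring
  have h2 : 0 ≤ τ ^ 2 / (1 + τ) := by positivity
  linarith

/-! ### The witness memory `C(t) = 4(1+|t|)⁻³ − (1+|t|)⁻²`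

(a positive peak followed by a negative lobe with tail `−t⁻²`; kept as a hypothesis `hC` on an
abstract `C` so that this file declares no definition) -/

section Witness

variable {C : ℝ → ℝ} (hC : ∀ t : ℝ, C t = 4 * ((1 + |t|)⁻¹) ^ 3 - ((1 + |t|)⁻¹) ^ 2)
include hC

/-- The witness on `t ≥ 0`: `4(1+t)⁻³ − (1+t)⁻²`. [folklore] -/
theorem witness_of_nonneg {t : ℝ} (ht : 0 ≤ t) :
    C t = 4 * ((1 + t)⁻¹) ^ 3 - ((1 + t)⁻¹) ^ 2 := by
  rw [hC, abs_of_nonneg ht]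

/-- The witness memory is continuous on `ℝ`. [folklore] -/
theorem continuous_witness : Continuous C := by
  have h1 : Continuous fun t : ℝ => (1 + |t|)⁻¹ :=
    (continuous_const.add continuous_abs).inv₀ fun t => (by positivity : (0:ℝ) < 1 + |t|).ne'
  rw [show C = fun t : ℝ => 4 * ((1 + |t|)⁻¹) ^ 3 - ((1 + |t|)⁻¹) ^ 2 from funext hC]
  exact (continuous_const.mul (h1.pow 3)).sub (h1.pow 2)

/-- The witness memory is even (time-reversal symmetric). [folklore] -/
theorem witness_neg (t : ℝ) : C (-t) = C t := by
  rw [hC, hC, abs_neg]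

/-- `C(0) = 3`. [folklore] -/
theorem witness_zero : C 0 = 3 := by
  rw [hC]; norm_num

/-- `|C(t)| ≤ C(0)` (with `u = (1+|t|)⁻¹ ∈ (0,1]`: `−3 ≤ 4u³ − u² ≤ 3`). [folklore] -/
theorem abs_witness_le (t : ℝ) : |C t| ≤ C 0 := by
  rw [witness_zero hC, hC]
  have hpos : 0 < 1 + |t| := by positivity
  set u : ℝ := (1 + |t|)⁻¹ with hu
  have hu0 : 0 < u := inv_pos.mpr hpos
  have hu1 : u ≤ 1 := (inv_le_one₀ hpos).mpr (by linarith [abs_nonneg t])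
  have hu2 : u ^ 2 ≤ 1 := pow_le_one₀ hu0.le hu1
  have hu3 : 0 ≤ u ^ 3 := by positivity
  rw [abs_le]
  constructor
  · nlinarith
  · nlinarith [mul_nonneg (sub_nonneg.mpr hu1) (by positivity : (0:ℝ) ≤ 4 * u ^ 2 + 3 * u + 3)]

/-- The witness memory is integrable on `(0,∞)` (`C ∈ L¹`). [folklore] -/
theorem integrableOn_witness : IntegrableOn C (Ioi 0) :=
  integrableOn_pieces.congr_fun (fun _ ht => (witness_of_nonneg hC (le_of_lt ht)).symm)
    measurableSet_Ioi

/-- `∫₀^∞ C = 1`. [folklore] -/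
theorem integral_witness : ∫ t in Ioi (0:ℝ), C t = 1 := by
  rw [setIntegral_congr_fun measurableSet_Ioi
    (fun t (ht : t ∈ Ioi (0:ℝ)) => witness_of_nonneg hC (le_of_lt ht))]
  exact integral_pieces

/-- The Green–Kubo integral of the witness is positive. [folklore] -/
theorem integral_witness_pos : 0 < ∫ t in Ioi (0:ℝ), C t := by
  rw [integral_witness hC]; norm_num

/-- Closed form of the heat variance of the witness: `V(τ) = 2(τ(τ−1)/(1+τ) + log(1+τ))`
(fundamental theorem of calculus with the antiderivative
`−2(τ+1)(1+s)⁻² + (τ+5)(1+s)⁻¹ + log(1+s)` of `(τ−s)C(s)`). [folklore] -/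
theorem heatVariance_witness {τ : ℝ} (hτ : 0 ≤ τ) :
    (2 * ∫ s in Ioc (0:ℝ) τ, (τ - s) * C s)
      = 2 * (τ * (τ - 1) / (1 + τ) + Real.log (1 + τ)) := by
  congr 1
  rw [← intervalIntegral.integral_of_le hτ]
  have hderiv : ∀ x ∈ uIcc 0 τ, HasDerivAt
      (fun s : ℝ => -2 * (τ + 1) * ((1 + s)⁻¹ * (1 + s)⁻¹) + (τ + 5) * (1 + s)⁻¹
        + Real.log (1 + s))
      ((τ - x) * C x) x := by
    intro x hx
    rw [uIcc_of_le hτ] at hx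
    have hx0 : 0 ≤ x := hx.1
    have hne : (1 + x) ≠ 0 := by positivity
    have hu := hasDerivAt_inv_one_add hx0
    have hl : HasDerivAt (fun s : ℝ => Real.log (1 + s)) (1 / (1 + x)) x :=
      ((hasDerivAt_id' x).const_add (1:ℝ)).log hne
    have h := (((hu.fun_mul hu).const_mul (-2 * (τ + 1))).fun_add (hu.const_mul (τ + 5))).fun_add hl
    refine h.congr_deriv ?_
    rw [witness_of_nonneg hC hx0]
    field_simp
    ring
  have hint : IntervalIntegrable (fun s => (τ - s) * C s) volume 0 τ :=
    ((continuous_const.sub continuous_id).mul (continuous_witness hC)).intervalIntegrable 0 τ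
  rw [intervalIntegral.integral_eq_sub_of_hasDerivAt hderiv hint]
  have hne : (1 + τ) ≠ 0 := by positivity
  simp only [add_zero, inv_one, mul_one, Real.log_one]
  field_simp
  ring

end Witness

/-- **The analytic shell does not imply quasi-superadditivity** — the crux
`CageBudgetFekete.QuasiSuperadditiveHeatVariance` WITHOUT the dynamics (the guarded pair
`(μ_T, D)` replaced by the analytic properties of the memory that `HeatVarianceCalculus` /
`FourierGreenKubo.GreenKubo` provide) is false: continuity, evenness, `|C| ≤ C(0)`,
`C ∈ L¹(0,∞)` with positive Green–Kubo integral and a nonnegative heat variance do NOT give a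
bounded superadditivity defect — witness `C(t) = 4(1+|t|)⁻³ − (1+|t|)⁻²`, whose defect
`2V(n) − V(2n)` grows like `2 log n`.  Any proof of the crux must therefore use the dynamics
beyond the `L¹` Green–Kubo content (the load-bearing quantity is the first moment `∫ t·C_T⁻`).
[folklore] -/
theorem quasiSuperadditiveHeatVariance_false_without_dynamics :
    ¬ (∀ C : ℝ → ℝ, Continuous C → (∀ t : ℝ, C (-t) = C t) → (∀ t : ℝ, |C t| ≤ C 0) →
        IntegrableOn C (Ioi 0) → 0 < ∫ t in Ioi (0:ℝ), C t →
        ∀ V : ℝ → ℝ, V = (fun τ : ℝ => 2 * ∫ s in Ioc (0:ℝ) τ, (τ - s) * C s) →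
        (∀ τ : ℝ, 0 ≤ τ → 0 ≤ V τ) →
        ∃ K : ℝ, 0 ≤ K ∧ ∀ s t : ℝ, 0 ≤ s → 0 ≤ t → V s + V t ≤ V (s + t) + K) := by
  intro h
  have hC : ∀ t : ℝ, (fun t : ℝ => 4 * ((1 + |t|)⁻¹) ^ 3 - ((1 + |t|)⁻¹) ^ 2) t
      = 4 * ((1 + |t|)⁻¹) ^ 3 - ((1 + |t|)⁻¹) ^ 2 := fun _ => rfl
  obtain ⟨K, hK, hQ⟩ := h _ (continuous_witness hC) (witness_neg hC) (abs_witness_le hC)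
    (integrableOn_witness hC) (integral_witness_pos hC) _ rfl (fun τ hτ => by
      have e := heatVariance_witness hC hτ
      beta_reduce at e ⊢
      rw [e]
      exact heatVariance_closedForm_nonneg hτ)
  set c : ℝ := (K + 9) / 2 with hc
  set n : ℝ := 2 * Real.exp c with hn
  have hn0 : 0 ≤ n := by positivity
  have hnn : 0 ≤ n + n := by positivity
  have h1 := hQ n n hn0 hn0
  have e1v := heatVariance_witness hC hn0
  have e2v := heatVariance_witness hC hnn
  beta_reduce at h1 e1v e2v
  rw [e1v, e2v] at h1
  have hn1 : (1 + n) ≠ 0 := by positivity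
  have hn2 : (1 + (n + n)) ≠ 0 := by positivity
  -- logarithms: log(1+n) ≥ log 2 + c and log(1+2n) ≤ log 2 + log(1+n)
  have hA : Real.log 2 + c ≤ Real.log (1 + n) := by
    have h2 : Real.log (2 * Real.exp c) = Real.log 2 + c := by
      rw [Real.log_mul two_ne_zero (Real.exp_pos c).ne', Real.log_exp]
    rw [← h2]
    exact Real.log_le_log (by positivity) (by linarith)
  have hB : Real.log (1 + (n + n)) ≤ Real.log 2 + Real.log (1 + n) := by
    rw [← Real.log_mul two_ne_zero hn1]
    exact Real.log_le_log (by positivity) (by linarith)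
  -- rational parts
  have e1 : n * (n - 1) / (1 + n) = n - 2 + 2 / (1 + n) := by
    field_simp
    ring
  have e2 : (n + n) * (n + n - 1) / (1 + (n + n)) = (n + n) - 2 + 2 / (1 + (n + n)) := by
    field_simp
    ring
  have f1 : 0 ≤ 2 / (1 + n) := by positivity
  have f2 : 2 / (1 + (n + n)) ≤ 2 := by
    rw [div_le_iff₀ (by positivity)]
    nlinarith
  linarith

end Summit.AtomisticToContinuum.FouriersLaw.Theorems.QuasiSuperadditiveHeatVariance.Negative
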